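import Mathlib
import Summits.MatrixMultiplication.MatrixMultiplication.Theses.AbelianSTPPCensusVP

/-!
# Route AbelianSTPPCensusVP — the Assembly item (stmt-MatrixMultiplication-19192)

`GrynkiewiczWeak → ShapeExclusionVP337 → NoAbelianSTPPHost_250_337`: pure logic over the landed glue
`AbelianTECensus.noAbelianSTPPHostUpTo_of_two`, `AbelianTECensus.sieveSound` (vM soundness),
`STPPRepCount.u11GSound_of_grynkiewiczWeak` (U11-G soundness from the weak Grynkiewicz form, p415742) and
`STPPRepCount.u11PSound` (U11-P = Pollard at prime orders, p415256).  Cell mm-stpp, planner sketch routeVP3 (gen 7),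
farm-checked; to be landed by a prover/theory seat (planners do not propose).
-/

set_option linter.dupNamespace false -- `MatrixMultiplication.MatrixMultiplication` (summit = problem, D-0017)

namespace Summit.MatrixMultiplication.MatrixMultiplication.Theorems

open Finset

/-- The assembly implication of route `AbelianSTPPCensusVP` holds (item stmt-MatrixMultiplication-19192). [original] -/
theorem AssemblyVP_proof :
    Summit.MatrixMultiplication.MatrixMultiplication.Theses.AbelianSTPPCensusVP.Assembly := by
  intro hG hX
  classical
  unfold NoAbelianSTPPHost_250_337
  refine AbelianTECensus.noAbelianSTPPHostUpTo_of_two (τ := 5 / 2) (by norm_num) (by norm_num) ?_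
  intro H _ _ hM N A B C hS hne hN
  have hadm : SieveAdmissibleVP (Fintype.card H) (fun i => (A i).card) (fun i => (B i).card) (fun i => (C i).card) :=
    ⟨AbelianTECensus.sieveSound H N A B C hS hne, STPPRepCount.u11GSound_of_grynkiewiczWeak hG H N A B C hS hne,
      fun hp => STPPRepCount.u11PSound H hp N A B C hS hne⟩
  have h := hX N (Fintype.card H) _ _ _ hN hM hadm
  unfold Beats at h
  push Not at h
  simpa [shapeVol] using h

end Summit.MatrixMultiplication.MatrixMultiplication.Theorems
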